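import Summits.Ventures.QEC.Census.CSSNormalFormSAT.EncodeSound
import Summits.Ventures.QEC.Census.CSSNormalFormK1
import HarnessLib

/-!
# Bridge, `(Z)` side: from the 𝔽₂ condition `(Z)` of the normal form to the counting condition `ZCond` (KERNEL-PLAN item 3a)

For `A : Matrix (Fin b) (Fin m) (ZMod 2)` and the sorted vector `s = 1^w 0^{m−w}` (`sVec`), condition `(Z)` of
`CSSNormalForm.exists_normalForm` — `∀ v, d ≤ wt v + wt (v ᵥ* A + s)` — implies `ZCond c (boolOf c A)` for the Boolean matrix
`boolOf c A i j = [A i j = 1]` (`EncodeSound.lean`): apply `(Z)` to the indicator vector of each listed row set `V` and count.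
(The `(X)` side, the reindexing `{q // q ∈ I} ≃ Fin b` and the sorting of `s` are sibling files.) [folklore]
-/

set_option autoImplicit false

namespace Summit.Ventures.QEC.Census.CSSNormalFormSAT

open NFEnc Matrix

/-- The sorted syndrome-offset vector `s = 1^w 0^{m−w}`. (definition) -/
def sVec (c : Cfg) : Fin c.m → ZMod 2 := fun j => if j.val < c.w then 1 else 0

/-- The Boolean matrix of `A` (entries `[A i j = 1]`, `false` out of range). (definition) -/
def boolOf (c : Cfg) (A : Matrix (Fin c.b) (Fin c.m) (ZMod 2)) (i j : ℕ) : Bool :=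
  if h : i < c.b ∧ j < c.m then decide (A ⟨i, h.1⟩ ⟨j, h.2⟩ = 1) else false

/-- The indicator vector of a list of row indices. (definition) -/
def indVec (b : ℕ) (V : List ℕ) : Fin b → ZMod 2 := fun i => if i.val ∈ V then 1 else 0

/-- Indicator sums compute parities: `Σ_{i ∈ V} [f i] = [parity (V.map f)]` in `ZMod 2`. [folklore] -/
theorem sum_map_ite_eq_parity (f : ℕ → Bool) :
    ∀ V : List ℕ, (V.map fun i => if f i then (1 : ZMod 2) else 0).sum = if parity (V.map f) then 1 else 0
  | [] => by simp [parity]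
  | a :: V => by
    rw [List.map_cons, List.sum_cons, sum_map_ite_eq_parity f V]
    simp only [List.map_cons, parity]
    cases f a <;> cases parity (V.map f) <;> decide

/-- `indVec` of `a :: V` with `a ∉ V`, `a < b`: adds the basis vector at `a`. [folklore] -/
theorem indVec_cons {b : ℕ} (a : ℕ) (V : List ℕ) (ha : a ∉ V) (hab : a < b) :
    indVec b (a :: V) = indVec b V + Pi.single (⟨a, hab⟩ : Fin b) 1 := by
  funext i
  by_cases hi : i = ⟨a, hab⟩
  · subst hi
    simp [indVec, ha]
  · have hia : i.val ≠ a := fun h => hi (Fin.ext h)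
    simp [indVec, hia, hi]

/-- The `j`-th entry of `indVec V ᵥ* A` is the indicator sum over `V` (for `V` without duplicates, entries `< b`). [folklore] -/
theorem indVec_vecMul (c : Cfg) (A : Matrix (Fin c.b) (Fin c.m) (ZMod 2)) (J : Fin c.m) :
    ∀ V : List ℕ, V.Nodup → (∀ i ∈ V, i < c.b) →
      (indVec c.b V ᵥ* A) J = (V.map fun i => if boolOf c A i J.val then (1 : ZMod 2) else 0).sum
  | [], _, _ => by
    have : indVec c.b [] = 0 := by funext i; simp [indVec]
    simp [this]
  | a :: V, hnd, hlt => by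
    have ha : a ∉ V := (List.nodup_cons.1 hnd).1
    have hab : a < c.b := hlt a List.mem_cons_self
    rw [indVec_cons a V ha hab, add_vecMul, Pi.add_apply,
      indVec_vecMul c A J V (List.nodup_cons.1 hnd).2 (fun i hi => hlt i (List.mem_cons_of_mem _ hi)),
      List.map_cons, List.sum_cons, add_comm]
    congr 1
    rw [Matrix.single_one_vecMul]
    have hbool : boolOf c A a J.val = decide (A ⟨a, hab⟩ J = 1) := by
      simp [boolOf, hab, J.isLt]
    rw [hbool]
    by_cases h1 : A ⟨a, hab⟩ J = 1
    · simp [h1]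
    · have z2 : ∀ x : ZMod 2, x ≠ 0 → x = 1 := by decide
      have h0 : A ⟨a, hab⟩ J = 0 := by
        by_contra h; exact h1 (z2 _ h)
      simp [h0]

/-- `wt (indVec V) = |V|` for `V` without duplicates, entries `< b`. [folklore] -/
theorem hammingNorm_indVec (b : ℕ) (V : List ℕ) (hnd : V.Nodup) (hlt : ∀ i ∈ V, i < b) :
    hammingNorm (indVec b V) = V.length := by
  rw [hammingNorm]
  have hset : (Finset.univ.filter fun i : Fin b => indVec b V i ≠ 0) = V.toFinset.attachFin (fun i hi => hlt i (List.mem_toFinset.1 hi)) := by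
    ext i
    simp [indVec, Finset.mem_attachFin]
  rw [hset, Finset.card_attachFin, List.toFinset_card_of_nodup hnd]

/-- **Bridge, `(Z)` side.** [folklore] -/
theorem ZCond_of_Z (c : Cfg) (A : Matrix (Fin c.b) (Fin c.m) (ZMod 2))
    (hZ : ∀ v : Fin c.b → ZMod 2, c.d ≤ hammingNorm v + hammingNorm (v ᵥ* A + sVec c)) :
    ZCond c (boolOf c A) := by
  intro V hV
  have hV' := hV
  simp only [rowSets, List.mem_flatMap] at hV'
  obtain ⟨t, -, ht⟩ := hV'
  obtain ⟨-, hnd, hlt⟩ := combos_spec c.b (t + 1) V ht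
  have h := hZ (indVec c.b V)
  rw [hammingNorm_indVec c.b V hnd hlt] at h
  have hcount : hammingNorm (indVec c.b V ᵥ* A + sVec c) =
      ((Finset.range c.m).filter fun j => zvalOf c (boolOf c A) V j = true).card := by
    rw [hammingNorm]
    have hset : (Finset.univ.filter fun J : Fin c.m => (indVec c.b V ᵥ* A + sVec c) J ≠ 0) =
        ((Finset.range c.m).filter fun j => zvalOf c (boolOf c A) V j = true).attachFin
          (fun j hj => Finset.mem_range.1 (Finset.mem_filter.1 hj).1) := by
      ext J
      simp only [Finset.mem_filter, Finset.mem_univ, true_and, Finset.mem_attachFin, Finset.mem_range, J.isLt]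
      have z2 : ∀ x : ZMod 2, x ≠ 0 ↔ x = 1 := by decide
      rw [Pi.add_apply, indVec_vecMul c A J V hnd hlt, sum_map_ite_eq_parity, z2, zvalOf, sVec]
      cases parity (V.map fun i => boolOf c A i J.val) <;> by_cases hJ : J.val < c.w <;> simp [hJ]
    rw [hset, Finset.card_attachFin]
  rw [hcount] at h
  exact h

end Summit.Ventures.QEC.Census.CSSNormalFormSAT
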